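import Summits.QuantumAdvantage.QuantumAdvantage.Theorems.ThirdFactorialPincerSexticEscapeCountOfZeroFree
import Summits.QuantumAdvantage.QuantumAdvantage.Theorems.ThirdFactorialPincerSexticEscapeCountQuadraticSubfield
import Literature.NumberTheory.LFunctions.StarkGaloisQuadraticSubfield
import Literature.NumberTheory.QuadraticFields.QuadraticDedekindZetaZeros
import HarnessLib

/-!
# The crux `SexticEscapeCount` — PROVED (unconditionally: no GRH, no Siegel hypothesis, no named fact)

Topic `Summits/QuantumAdvantage/QuantumAdvantage/Theorems`; CLOSES the crux `SexticEscapeCount`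
(stmt-QuantumAdvantage-14545) of route `ThirdFactorialPincer` — "the GRH substitute for
`F_p = K_p(ω)`": an absolute `C` such that for every prime `p ≡ 1 (3)`, every abelian sextic number
field `F` of discriminant `−27p⁴`, every `x ≥ p^C` and every proper subgroup `M < Cl(𝓞 F)`,
`π(x) ≤ 32 · #{P : N P prime ≤ x, [P] ∉ M}` — with the toolkit of cell B2b-1 (linnik-cubic, crux
`DegreeOnePrimesEscape`). HONEST FRAMING: the value of this file is a THEOREM (kernel-checked,
axioms `propext`, `Classical.choice`, `Quot.sound`) — not summit progress (route `ThirdFactorialPincer`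
still rests on the hypothesis-type target `GaussFactorialHard` and the cruxes `IdealLegOfEscape`,
`ArgLeg`, `FactorialFromPincer`).

`ThirdFactorialPincerSexticEscapeCountOfZeroFree.lean` proved the crux from ONE classical input: a
uniform real-zero-free interval `[1 − c/log|d_F|, 1)` of `ζ_F` for the abelian sextic fields `F` of
discriminant `−27p⁴` (`= K_p(ω)`). Here that analytic input is discharged down to a purely
ALGEBRAIC statement about those fields:

* `exists_zeroFree_quadratic_of_discr_eq_neg_three` — there is an absolute `c₀ ∈ (0, ¼]` such that
  EVERY quadratic number field `k` with `d_k = −3` has `ζ_k(σ) ≠ 0` for `1 − c₀ ≤ σ < 1`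
  (`ζ_k = ζ · L(s, κ)` with `κ ≠ 1` the Kronecker character modulo `|d_k| = 3`,
  `Quadratic.exists_kroneckerChar`; `ζ(σ) < 0` on `(0,1)`; `L(1, κ) ≠ 0` and continuity, uniformly
  over the finitely many characters modulo `3`).
* `sexticEscapeCount_of_quadraticSubfield_discr` — **`SexticEscapeCount` (by name) from the
  identification "every quadratic subfield of an abelian sextic field of discriminant `−27p⁴`
  (`p ≡ 1 (3)` prime) has discriminant `−3`"** (i.e. is `ℚ(√−3) = ℚ(ω)`): by Stark's Theorem 3 for
  Galois fields (`dedekindZetaCont_ne_zero_of_isGalois_of_quadratic`, Literature) a real zero of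
  `ζ_F` in `[1 − c₀/log|d_F|, 1) ⊆ [1 − 1/(4 log|d_F|), 1)` would be a zero of `ζ_k` for a quadratic
  subfield `k`, excluded by the first theorem; then `sexticEscapeCount_of_zeroFree`.

* `sexticEscapeCount_proof` — **the crux itself**, feeding the identification
  `discr_quadratic_eq_neg_three` (`ThirdFactorialPincerSexticEscapeCountQuadraticSubfield.lean`:
  inertia groups in the abelian `Gal(F/ℚ)` of order `6`, `d_F = −27p⁴`) into the previous theorem
  (`p ≡ 1 (3)` prime forces `p ≥ 7 ≥ 5`).

Architecture of the whole proof (all kernel-checked, standard axioms): log-free zero density in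
every degree (`logFreeDensity_classGroup_all`, `logFreeDensity_dedekindZeta₁_all`; Weiss 1983 Thm 4.3 /
Thorner–Zaman 2019 Thm 3.2 without Deuring–Heilbronn) → degree-local one-sided per-character deficit
T4 and lower prime ideal theorem dichotomy T5 at `n = 6` → Stark's Lemma 4 residue bound from the
zero-free interval → per-field composition (subgroup orthogonality; `CubicEscape.escape_of_inputs`)
= `escape_of_zeroFree`; zero-free interval of `ζ_F`: Stark 1974 Thm 3 for the Galois field `F`
(`dedekindZetaCont_ne_zero_of_isGalois_of_quadratic`) + `ζ_k = ζ · L(s, χ₋₃)` for the quadratic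
subfield `k = ℚ(√−3)` (`L(1, χ) ≠ 0`, continuity; `ζ(σ) < 0` on `(0,1)`) + the identification.
PLACEMENT: on paper the crux follows from Thorner–Zaman 2019 Thm 1.4 (with Deuring–Heilbronn) plus
Kadiri's explicit zero-free regions; no printed source states it; here it is derived WITHOUT the
Deuring–Heilbronn phenomenon, by one-sidedness (a real zero of a non-trivial class-group twist only
depresses the character sum) and Stark–Heilbronn (a real zero of `ζ_F` near `1` lives in `ζ_{ℚ(√−3)}`,
which has none near `1`).
-/

noncomputable section

-- the `Algebra ℚ ↥k` diamond (`IntermediateField.algebra` vs `DivisionRing.toRatAlgebra`) is only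
-- defeq at default transparency (as in `ThirdFactorialPincerSexticEscapeCountQuadraticSubfield.lean`).
set_option backward.isDefEq.respectTransparency false

open scoped NumberField nonZeroDivisors ComplexOrder
open Literature.NumberTheory.LFunctions Literature.NumberTheory.LFunctions.NumberField

namespace Summit.QuantumAdvantage.QuantumAdvantage.Theorems.SexticEscapeCount

/-! ### A uniform zero-free interval for the quadratic fields of discriminant `−3` -/

/-- For every Dirichlet character `κ` modulo `3` there is `δ > 0` such that, if `κ ≠ 1`,
`L(σ, κ) ≠ 0` for real `σ ∈ [1 − δ, 1]` (`L(1, κ) ≠ 0` and continuity of the entire function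
`L(·, κ)`). [folklore] -/
theorem exists_LFunction_ne_zero_near_one (κ : DirichletCharacter ℂ 3) :
    ∃ δ : ℝ, 0 < δ ∧ (κ ≠ 1 → ∀ σ : ℝ, 1 - δ ≤ σ → σ ≤ 1 → κ.LFunction (σ : ℂ) ≠ 0) := by
  by_cases hκ : κ = 1
  · exact ⟨1, one_pos, fun h => absurd hκ h⟩
  · have hcont : ContinuousAt (fun s : ℂ => κ.LFunction s) 1 :=
      ((DirichletCharacter.differentiable_LFunction hκ).continuous).continuousAt
    have hne : κ.LFunction 1 ≠ 0 := DirichletCharacter.LFunction_apply_one_ne_zero hκ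
    have hev : ∀ᶠ s in nhds (1 : ℂ), κ.LFunction s ≠ 0 := hcont.eventually_ne hne
    obtain ⟨δ, hδ, hball⟩ := Metric.eventually_nhds_iff.mp hev
    refine ⟨δ / 2, by positivity, fun _ σ h1 h2 => hball ?_⟩
    rw [Complex.dist_eq, show (σ : ℂ) - 1 = ((σ - 1 : ℝ) : ℂ) by push_cast; ring, Complex.norm_real,
      Real.norm_eq_abs, abs_sub_comm, abs_of_nonneg (by linarith)]
    linarith

/-- **Uniform zero-free interval for the quadratic fields of discriminant `−3`**: there is an
absolute `c₀ ∈ (0, ¼]` such that every quadratic number field `k` with `d_k = −3` has `ζ_k(σ) ≠ 0`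
for all real `σ` with `1 − c₀ ≤ σ < 1`. (`ζ_k(s) = ζ(s) L(s, κ)` off `s = 1` with `κ ≠ 1` the
Kronecker character modulo `|d_k| = 3`; `ζ(σ) < 0` on `(0, 1)`; `L(σ, κ) ≠ 0` near `1`, uniformly over
the finitely many characters modulo `3`.) [folklore] -/
theorem exists_zeroFree_quadratic_of_discr_eq_neg_three :
    ∃ c₀ : ℝ, 0 < c₀ ∧ c₀ ≤ 1 / 4 ∧ ∀ (k : Type) [Field k] [NumberField k], Module.finrank ℚ k = 2 →
      NumberField.discr k = -3 → ∀ σ : ℝ, 1 - c₀ ≤ σ → σ < 1 → dedekindZetaCont k σ ≠ 0 := by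
  classical
  haveI : Fintype (DirichletCharacter ℂ 3) := Fintype.ofFinite _
  choose δ hδ0 hδ using exists_LFunction_ne_zero_near_one
  set δ₀ : ℝ := Finset.univ.inf' Finset.univ_nonempty δ with hδ₀
  have hδ₀0 : 0 < δ₀ := by
    rw [hδ₀, Finset.lt_inf'_iff]
    exact fun κ _ => hδ0 κ
  have hδ₀le : ∀ κ, δ₀ ≤ δ κ := fun κ => Finset.inf'_le _ (Finset.mem_univ κ)
  refine ⟨min δ₀ (1 / 4), lt_min hδ₀0 (by norm_num), min_le_right _ _, ?_⟩
  intro k _ _ hk2 hdk σ hσ hσ1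
  have hσ0 : 0 < σ := by
    have := min_le_right δ₀ (1 / 4 : ℝ); linarith
  have hs1 : (σ : ℂ) ≠ 1 := fun h => hσ1.ne (by exact_mod_cast h)
  obtain ⟨M, hM0, κ, hM, hκ, -, hfac⟩ :=
    Literature.NumberTheory.QuadraticFields.Quadratic.exists_kroneckerChar (K := k) hk2
  have hM3 : M = 3 := by rw [hM, hdk]; rfl
  subst hM3
  rw [Ne, Literature.NumberTheory.QuadraticFields.Quadratic.dedekindZetaCont_eq_zero_iff hκ hfac hs1,
    not_or]
  refine ⟨(riemannZeta_neg_of_pos_of_lt_one hσ0 hσ1).ne, ?_⟩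
  refine hδ κ hκ σ ?_ hσ1.le
  have h1 := hδ₀le κ
  have h2 := min_le_left δ₀ (1 / 4 : ℝ)
  linarith

/-! ### The crux from the identification of the quadratic subfield -/

/-- **`SexticEscapeCount` (crux of route `ThirdFactorialPincer`, by name) from the ALGEBRAIC
identification of the quadratic subfield**: if every quadratic subfield `k` of every abelian
sextic number field `F` of discriminant `−27p⁴` (`p ≡ 1 (3)` prime) has `d_k = −3`, the crux holds.
Proof: with `c₀` from `exists_zeroFree_quadratic_of_discr_eq_neg_three`, for
`σ ∈ [1 − c₀/log|d_F|, 1) ⊆ [1 − 1/(4 log|d_F|), 1) ∩ [1 − c₀, 1)` a zero of `ζ_F` would be a zero of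
`ζ_k` for a quadratic subfield `k` (Stark 1974 Thm 3 for the Galois field `F`,
`dedekindZetaCont_ne_zero_of_isGalois_of_quadratic`), which the first theorem excludes; conclude
by `sexticEscapeCount_of_zeroFree`. -/
theorem sexticEscapeCount_of_quadraticSubfield_discr
    (hq : ∀ (p : ℕ) (F : Type) [Field F] [NumberField F], p.Prime → p % 3 = 1 →
      Module.finrank ℚ F = 6 → IsGalois ℚ F → (∀ σ τ : F ≃ₐ[ℚ] F, σ * τ = τ * σ) →
      NumberField.discr F = -(27 * (p : ℤ) ^ 4) →
      ∀ k : IntermediateField ℚ F, Module.finrank ℚ k = 2 → NumberField.discr k = -3) :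
    Summit.QuantumAdvantage.QuantumAdvantage.Theses.ThirdFactorialPincer.SexticEscapeCount := by
  obtain ⟨c₀, hc₀, hc₀4, hZk⟩ := exists_zeroFree_quadratic_of_discr_eq_neg_three
  refine sexticEscapeCount_of_zeroFree ⟨c₀, hc₀, ?_⟩
  intro p F _ _ hp hp3 hF6 hGal hab hdisc σ hσ hσ1
  haveI := hGal
  have hF : 1 < Module.finrank ℚ F := by rw [hF6]; norm_num
  -- `|d_F| ≥ 3`, so `log|d_F| > 1`
  set d : ℝ := ((NumberField.discr F).natAbs : ℝ) with hd
  have hd3 : (3 : ℝ) ≤ d := by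
    have h2 := NumberField.abs_discr_gt_two hF
    rw [hd, Nat.cast_natAbs]
    exact_mod_cast (show (3 : ℤ) ≤ |NumberField.discr F| by omega)
  have hlog1 : 1 < Real.log d := by
    rw [← Real.log_exp 1]
    refine Real.log_lt_log (Real.exp_pos 1) (lt_of_lt_of_le ?_ hd3)
    have := Real.exp_one_lt_d9
    linarith
  have hlog0 : 0 < Real.log d := by linarith
  -- the interval lies in Stark's box and in `[1 − c₀, 1)`
  have hσbox : 1 - 1 / (4 * Real.log d) ≤ σ := by
    have : c₀ / Real.log d ≤ 1 / (4 * Real.log d) := by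
      rw [div_le_div_iff₀ hlog0 (by positivity)]
      nlinarith
    linarith
  have hσc₀ : 1 - c₀ ≤ σ := by
    have : c₀ / Real.log d ≤ c₀ := div_le_self hc₀.le hlog1.le
    linarith
  exact dedekindZetaCont_ne_zero_of_isGalois_of_quadratic F hF hσbox hσ1
    (fun k hk2 => hZk k hk2 (hq p F hp hp3 hF6 hGal hab hdisc k hk2) σ hσc₀ hσ1)

/-! ### The crux -/

/-- **`SexticEscapeCount` holds** (crux of route `ThirdFactorialPincer`, stmt-QuantumAdvantage-14545):
there is an absolute `C : ℕ` such that for every prime `p ≡ 1 (mod 3)`, every abelian sextic number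
field `F` of discriminant `−27p⁴`, every `x ≥ p^C` and every proper subgroup `M` of `Cl(𝓞 F)`,
`π(x) ≤ 32 · #{P prime of 𝓞 F : N P prime, N P ≤ x, [P] ∉ M}`. Unconditional: from
`sexticEscapeCount_of_quadraticSubfield_discr` and the identification `discr_quadratic_eq_neg_three`
(a prime `p ≡ 1 (3)` is `≥ 7`). -/
theorem sexticEscapeCount_proof :
    Summit.QuantumAdvantage.QuantumAdvantage.Theses.ThirdFactorialPincer.SexticEscapeCount :=
  sexticEscapeCount_of_quadraticSubfield_discr (fun p F _ _ hp hp3 hF6 hGal hab hdisc k hk => by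
    haveI := hGal
    have hp5 : 5 ≤ p := by
      by_contra h
      push Not at h
      interval_cases p <;> first | omega | exact absurd hp (by norm_num)
    exact discr_quadratic_eq_neg_three p hp hp5 hF6 hab hdisc k hk)

end Summit.QuantumAdvantage.QuantumAdvantage.Theorems.SexticEscapeCount

end
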